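import Literature.Combinatorics.Optimization.TracialDesigns
import HarnessLib

/-!
# Cell pnp-psdrank, route `ChebyshevTracialDesign`: LOCAL DEGENERACY of tight psd rectangles — on the tight neighbourhood of every matching the cut
# operators span a subspace of codimension at least `rank Y_M` (crux `TracialDecayExp20`, stmt-PneNP-19878)

Brick 40 (prover g9). The exact psd form of tight-freeness. For a 0/1 rectangle `X × Y`, tight-freeness says: no `U ∈ X` is tight with an `M ∈ Y`. For a
tight-orthogonal psd rectangle `(X, Y)` of dimension `r` (`X_U Y_M = 0` whenever `cc(U,M) = 1`) the operators do not vanish — they become LINEARLY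
DEGENERATE along the tight graph: for every matching `M` and every finite family `𝒰` of cuts tight with `M`,

  `rank(Σ_{U ∈ 𝒰} X_U) + rank(Y_M) ≤ r`      (`rank_sum_add_rank_le`),

i.e. the ranges of all `X_U`, `U` tight with `M`, lie in a common subspace of codimension `≥ rank Y_M` (for psd `X_U`, `range(Σ X_U) = Σ range(X_U)`),
and symmetrically `rank(X_U) + rank(Σ_{M ∈ ℳ} Y_M) ≤ r` for matchings tight with a cut `U` (`rank_add_rank_sum_le`). Since a matching of `K_n` is tight with
exponentially many `t`-cuts, a strategy using `Y_M ≠ 0` forces exponentially many cut operators into a proper subspace — the dimension-counting constraint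
that any 'directional structure' theorem for the crux starts from (MEMO-12 §2). Proof: `S·Y = 0 ⇒ range(Y) ≤ ker(S)` and rank–nullity.
[cite: Rothvoss2017, §2 (PDF p. 6)] [cite: BrietDadushPokutta2014, Thm. 6 (§3)]
Stature: support/instrument (linear algebra). WHAT THIS IS NOT: no bound on any value, nothing on psd rank of P_PM, no P-vs-NP content.
-/

set_option linter.dupNamespace false -- `Summit.PneNP.PneNP.…`: summit = sub-problem (D-0017)

noncomputable section

namespace Summit.PneNP.PneNP.Theorems.ChebyshevTracialDesignTightNeighbourhoodRank

open Finset Matrix Literature.Barriers.PneNP Literature.Combinatorics.Optimization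

variable {n : ℕ}

/-! ### §1 Rank–nullity for a vanishing product -/

/-- **`S·Y = 0 ⇒ rank S + rank Y ≤ r`** (real `r × r` matrices): the range of `Y` lies in the kernel of `S`. -/
theorem rank_add_rank_le_of_mul_eq_zero {r : ℕ} (S Y : Matrix (Fin r) (Fin r) ℝ) (h : S * Y = 0) : S.rank + Y.rank ≤ r := by
  have hrange : LinearMap.range Y.mulVecLin ≤ LinearMap.ker S.mulVecLin := by
    rintro v ⟨w, rfl⟩
    rw [LinearMap.mem_ker]
    change S *ᵥ (Y *ᵥ w) = 0
    rw [mulVec_mulVec, h, zero_mulVec]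
  have hrn := LinearMap.finrank_range_add_finrank_ker S.mulVecLin
  have hle := Submodule.finrank_mono hrange
  have hdom : Module.finrank ℝ (Fin r → ℝ) = r := by simp
  unfold Matrix.rank
  omega

/-! ### §2 Tight neighbourhoods of a tight-orthogonal psd rectangle -/

/-- **Local degeneracy, matching side.** For a tight-orthogonal psd rectangle `(X, Y)` of dimension `r`, a matching `M`, and any finite family `𝒰` of cuts
all tight with `M` (`cc(U,M) = 1`): `rank(Σ_{U∈𝒰} X_U) + rank(Y_M) ≤ r`. [cite: Rothvoss2017, §2 (PDF p. 6)] -/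
theorem rank_sum_add_rank_le {r : ℕ} {X : OddSet n → Matrix (Fin r) (Fin r) ℝ} {Y : PMatch n → Matrix (Fin r) (Fin r) ℝ} (hXY : IsPsdRect X Y)
    (M : PMatch n) (𝒰 : Finset (OddSet n)) (h𝒰 : ∀ U ∈ 𝒰, cc U M = 1) :
    (∑ U ∈ 𝒰, X U).rank + (Y M).rank ≤ r := by
  refine rank_add_rank_le_of_mul_eq_zero _ _ ?_
  rw [sum_mul]
  exact sum_eq_zero fun U hU => hXY.2.2 U M (h𝒰 U hU)

/-- **Local degeneracy, cut side.** For a tight-orthogonal psd rectangle `(X, Y)` of dimension `r`, a cut `U`, and any finite family `ℳ` of matchings all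
tight with `U`: `rank(X_U) + rank(Σ_{M∈ℳ} Y_M) ≤ r`. [cite: Rothvoss2017, §2 (PDF p. 6)] -/
theorem rank_add_rank_sum_le {r : ℕ} {X : OddSet n → Matrix (Fin r) (Fin r) ℝ} {Y : PMatch n → Matrix (Fin r) (Fin r) ℝ} (hXY : IsPsdRect X Y)
    (U : OddSet n) (ℳ : Finset (PMatch n)) (hℳ : ∀ M ∈ ℳ, cc U M = 1) :
    (X U).rank + (∑ M ∈ ℳ, Y M).rank ≤ r := by
  refine rank_add_rank_le_of_mul_eq_zero _ _ ?_
  rw [mul_sum]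
  exact sum_eq_zero fun M hM => hXY.2.2 U M (hℳ M hM)

/-- **Bicliques of the tight graph.** If every cut of `𝒰` is tight with every matching of `ℳ`, then `rank(Σ_{U∈𝒰} X_U) + rank(Σ_{M∈ℳ} Y_M) ≤ r`:
the span of the cut ranges and the span of the matching ranges have complementary dimensions. [cite: Rothvoss2017, §2 (PDF p. 6)] -/
theorem rank_sum_add_rank_sum_le {r : ℕ} {X : OddSet n → Matrix (Fin r) (Fin r) ℝ} {Y : PMatch n → Matrix (Fin r) (Fin r) ℝ} (hXY : IsPsdRect X Y)
    (𝒰 : Finset (OddSet n)) (ℳ : Finset (PMatch n)) (h : ∀ U ∈ 𝒰, ∀ M ∈ ℳ, cc U M = 1) :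
    (∑ U ∈ 𝒰, X U).rank + (∑ M ∈ ℳ, Y M).rank ≤ r := by
  refine rank_add_rank_le_of_mul_eq_zero _ _ ?_
  rw [sum_mul]
  refine sum_eq_zero fun U hU => ?_
  rw [mul_sum]
  exact sum_eq_zero fun M hM => hXY.2.2 U M (h U hU M hM)

/-- **Trace form under the projection normal form.** If the tight-orthogonal psd rectangle consists of projections (`X_U² = X_U`, `Y_M² = Y_M`; WLOG by
`…ProjectionNormalForm`), then on every tight pair `tr(X_U) + tr(Y_M) ≤ r` — the fractional shadow `x_U + y_M ≤ 1` of `x_U·y_M = 0`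
(`1 − X_U − Y_M` is again a projection). [cite: BrietDadushPokutta2014, Thm. 6 (§3)] -/
theorem trace_add_trace_le_of_proj {r : ℕ} {X : OddSet n → Matrix (Fin r) (Fin r) ℝ} {Y : PMatch n → Matrix (Fin r) (Fin r) ℝ} (hXY : IsPsdRect X Y)
    (hXp : ∀ U, X U * X U = X U) (hYp : ∀ M, Y M * Y M = Y M) (U : OddSet n) (M : PMatch n) (hUM : cc U M = 1) :
    (X U).trace + (Y M).trace ≤ r := by
  have hXY0 : X U * Y M = 0 := hXY.2.2 U M hUM
  have hXs : (X U)ᵀ = X U := by have e := (hXY.1 U).1.1.eq; rwa [conjTranspose_eq_transpose_of_trivial] at e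
  have hYs : (Y M)ᵀ = Y M := by have e := (hXY.2.1 M).1.1.eq; rwa [conjTranspose_eq_transpose_of_trivial] at e
  have hYX0 : Y M * X U = 0 := by
    have := congrArg transpose hXY0
    rwa [transpose_mul, hXs, hYs, transpose_zero] at this
  -- `Q = 1 − X − Y` satisfies `Q = Qᵀ Q`, hence is psd, hence `tr Q ≥ 0`
  set Q : Matrix (Fin r) (Fin r) ℝ := 1 - X U - Y M with hQ
  have hQQ : Q * Q = Q := by
    rw [hQ]
    simp only [Matrix.sub_mul, Matrix.mul_sub, Matrix.one_mul, Matrix.mul_one, hXp U, hYp M, hXY0, hYX0]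
    abel
  have hQs : Qᵀ = Q := by rw [hQ, transpose_sub, transpose_sub, transpose_one, hXs, hYs]
  have hQpsd : Q.PosSemidef := by
    have h := posSemidef_conjTranspose_mul_self Q
    rwa [conjTranspose_eq_transpose_of_trivial, hQs, hQQ] at h
  have htr := hQpsd.trace_nonneg
  rw [hQ, trace_sub, trace_sub, trace_one, Fintype.card_fin] at htr
  linarith

end Summit.PneNP.PneNP.Theorems.ChebyshevTracialDesignTightNeighbourhoodRank

end
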